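import Mathlib
import HarnessLib

/-!
# `DensityLadder.SeparatedTowerDensityLine` (item stmt-RiemannHypothesis-24918) — explicit window
# sums for the upper bound (steps (f), (g) of stub S1)

LINE L57 «sieve sight above the density line» (rh-idea-10 g1), crux K1 `SeparatedTowerDensityLine`,
stub S1 (seat memo `MEANVALUE-SECOND-READ.md`, assembly skeleton `S1-ASSEMBLY-SKELETON.lean` on
stmt-RiemannHypothesis-24918).  The window transform obeys `‖ĉ_ρ(1/A)‖ ≤ H₂(⌊γ⌋)` with the window
profile `H₂(n) = 4` for `|n| ≤ A+1` and `H₂(n) = (9/2)M₂A²/(|n|−1)²` beyond (files `…Transform`,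
`…TransformDecay`); this file bounds the window sums of that profile: `Σ_{n∈S} H₂(n) ≤ (30+18M₂)A`
for every finite `S ⊆ ℤ` (`sum_Ioo_inv_sq_le`), and proves the summability of the T-independent
far-tail profile `(j+2)^{3/4}/(j−1)²` (comparison with `j^{−5/4}`).
Cell rh-split, seat rh-split-prover-l57 g0.  RH-free, ζ-free; FRONTIER bookkeeping; nothing here
bears on the truth of RH.
-/

set_option linter.dupNamespace false

noncomputable section

open Finset

namespace Summit.RiemannHypothesis.RiemannHypothesis.Theorems.DensityLadderSeparatedTowerWindowSums

/-- Tail of `Σ 1/i²` over a finite set of integers beyond `A`: `Σ_{n∈S, |n| > A+1} 1/(|n|−1)² ≤ 4/A`.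
[folklore] -/
theorem sum_inv_sq_window_le (S : Finset ℤ) {A : ℝ} (hA : 1 ≤ A) :
    ∑ n ∈ S.filter (fun n : ℤ ↦ A + 1 < |(n : ℝ)|), 1 / ((|(n : ℝ)| - 1) ^ 2) ≤ 4 / A := by
  classical
  set S' := S.filter (fun n : ℤ ↦ A + 1 < |(n : ℝ)|) with hS'
  -- reindex by `i = |n| - 1 ∈ ℕ`, at most two `n` per `i`
  set k : ℕ := ⌊A⌋₊ with hk
  have hkA : (k : ℝ) ≤ A := Nat.floor_le (by linarith)
  have hAk : A < (k : ℝ) + 1 := Nat.lt_floor_add_one A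
  set idx : ℤ → ℕ := fun n ↦ n.natAbs - 1 with hidx
  have hmem : ∀ n ∈ S', 2 ≤ n.natAbs ∧ (k : ℕ) < idx n ∧
      1 / ((|(n : ℝ)| - 1) ^ 2) = (((idx n : ℕ) : ℝ) ^ 2)⁻¹ := by
    intro n hn
    rw [hS', Finset.mem_filter] at hn
    have habs : (n.natAbs : ℝ) = |(n : ℝ)| := by
      rw [Nat.cast_natAbs, Int.cast_abs]
    have h2r : (2 : ℝ) ≤ n.natAbs := by rw [habs]; linarith
    have h2 : 2 ≤ n.natAbs := by exact_mod_cast h2r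
    refine ⟨h2, ?_, ?_⟩
    · have : (k : ℝ) < (n.natAbs : ℝ) - 1 := by rw [habs]; linarith
      have hcast : ((idx n : ℕ) : ℝ) = (n.natAbs : ℝ) - 1 := by
        rw [hidx]; simp only; rw [Nat.cast_sub (by omega)]; simp
      exact_mod_cast (this.trans_le hcast.symm.le)
    · have hcast : ((idx n : ℕ) : ℝ) = |(n : ℝ)| - 1 := by
        rw [hidx]; simp only; rw [Nat.cast_sub (by omega), habs]; simp
      rw [hcast, one_div]
  -- compare with the sum over the image, fibres of size ≤ 2
  set N : ℕ := (S'.image idx).sup id + 1 with hN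
  have himg : S'.image idx ⊆ Finset.Ioo k N := by
    intro i hi
    rw [Finset.mem_Ioo]
    obtain ⟨n, hn, rfl⟩ := Finset.mem_image.1 hi
    refine ⟨(hmem n hn).2.1, ?_⟩
    have : idx n ≤ (S'.image idx).sup id := Finset.le_sup (f := id) (Finset.mem_image_of_mem idx hn)
    omega
  have hfib : ∀ i ∈ S'.image idx, ((S'.filter (fun n ↦ idx n = i)).card : ℝ) ≤ 2 := by
    intro i _
    have hsub : S'.filter (fun n ↦ idx n = i) ⊆ {((i + 1 : ℕ) : ℤ), -((i + 1 : ℕ) : ℤ)} := by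
      intro n hn
      rw [Finset.mem_filter] at hn
      have h2 := (hmem n hn.1).1
      rw [Finset.mem_insert, Finset.mem_singleton]
      have : n.natAbs = i + 1 := by rw [← hn.2, hidx]; simp only; omega
      exact Int.natAbs_eq_iff.1 this
    exact_mod_cast (Finset.card_le_card hsub).trans Finset.card_le_two
  calc ∑ n ∈ S', 1 / ((|(n : ℝ)| - 1) ^ 2)
      = ∑ n ∈ S', (((idx n : ℕ) : ℝ) ^ 2)⁻¹ := Finset.sum_congr rfl fun n hn ↦ (hmem n hn).2.2
    _ = ∑ i ∈ S'.image idx, ∑ n ∈ S'.filter (fun n ↦ idx n = i), (((idx n : ℕ) : ℝ) ^ 2)⁻¹ :=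
        (Finset.sum_fiberwise_of_maps_to (fun n hn ↦ Finset.mem_image_of_mem idx hn) _).symm
    _ = ∑ i ∈ S'.image idx, ((S'.filter (fun n ↦ idx n = i)).card : ℝ) * (((i : ℕ) : ℝ) ^ 2)⁻¹ := by
        refine Finset.sum_congr rfl fun i _ ↦ ?_
        rw [Finset.sum_congr rfl fun n hn ↦ by rw [(Finset.mem_filter.1 hn).2], Finset.sum_const,
          nsmul_eq_mul]
    _ ≤ ∑ i ∈ S'.image idx, 2 * (((i : ℕ) : ℝ) ^ 2)⁻¹ :=
        Finset.sum_le_sum fun i hi ↦ mul_le_mul_of_nonneg_right (hfib i hi) (by positivity)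
    _ = 2 * ∑ i ∈ S'.image idx, (((i : ℕ) : ℝ) ^ 2)⁻¹ := by rw [Finset.mul_sum]
    _ ≤ 2 * ∑ i ∈ Finset.Ioo k N, (((i : ℕ) : ℝ) ^ 2)⁻¹ := by
        refine mul_le_mul_of_nonneg_left ?_ (by norm_num)
        exact Finset.sum_le_sum_of_subset_of_nonneg himg fun i _ _ ↦ by positivity
    _ ≤ 2 * (2 / ((k : ℝ) + 1)) := mul_le_mul_of_nonneg_left (sum_Ioo_inv_sq_le k N) (by norm_num)
    _ ≤ 4 / A := by
        rw [mul_div_assoc', show (2 : ℝ) * 2 = 4 by norm_num]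
        exact div_le_div_of_nonneg_left (by norm_num) (by linarith) hAk.le

/-- **Window sums of the transform profile**: with
`H₂(n) = if |n| ≤ A+1 then 4 else (9/2)M₂A²/(|n|−1)²` (`M₂ ≥ 0`, `A ≥ 2`), every finite `S ⊆ ℤ` has
`Σ_{n∈S} H₂(n) ≤ (30 + 18M₂)·A`. [folklore] -/
theorem sum_window_profile_le (S : Finset ℤ) {A M₂ : ℝ} (hA : 2 ≤ A) (hM : 0 ≤ M₂) :
    ∑ n ∈ S, (if |(n : ℝ)| ≤ A + 1 then (4 : ℝ) else 9 / 2 * M₂ * A ^ 2 / ((|(n : ℝ)| - 1) ^ 2)) ≤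
      (30 + 18 * M₂) * A := by
  classical
  rw [← Finset.sum_filter_add_sum_filter_not S (fun n : ℤ ↦ |(n : ℝ)| ≤ A + 1)]
  have h1 : ∑ n ∈ S.filter (fun n : ℤ ↦ |(n : ℝ)| ≤ A + 1),
      (if |(n : ℝ)| ≤ A + 1 then (4 : ℝ) else 9 / 2 * M₂ * A ^ 2 / ((|(n : ℝ)| - 1) ^ 2)) ≤ 4 * (2 * A + 5) := by
    rw [Finset.sum_congr rfl fun n hn ↦ by rw [if_pos (Finset.mem_filter.1 hn).2], Finset.sum_const,
      nsmul_eq_mul]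
    have hcard : ((S.filter (fun n : ℤ ↦ |(n : ℝ)| ≤ A + 1)).card : ℝ) ≤ 2 * A + 5 := by
      have hsub : S.filter (fun n : ℤ ↦ |(n : ℝ)| ≤ A + 1) ⊆ Finset.Icc (-(⌊A + 1⌋₊ : ℤ)) (⌊A + 1⌋₊ : ℤ) := by
        intro n hn
        rw [Finset.mem_filter] at hn
        have h := abs_le.1 hn.2
        have hfl : A + 1 < (⌊A + 1⌋₊ : ℝ) + 1 := Nat.lt_floor_add_one _
        rw [Finset.mem_Icc]
        constructor
        · have : (-(⌊A + 1⌋₊ : ℝ) - 1 : ℝ) < (n : ℝ) := by linarith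
          have : (-(⌊A + 1⌋₊ : ℤ) - 1 : ℤ) < n := by exact_mod_cast this
          omega
        · have : (n : ℝ) < (⌊A + 1⌋₊ : ℝ) + 1 := by linarith
          have : n < (⌊A + 1⌋₊ : ℤ) + 1 := by exact_mod_cast this
          omega
      have := Finset.card_le_card hsub
      rw [Int.card_Icc] at this
      have hfl' : (⌊A + 1⌋₊ : ℝ) ≤ A + 1 := Nat.floor_le (by linarith)
      have hnn : ((⌊A + 1⌋₊ : ℤ) + 1 - -(⌊A + 1⌋₊ : ℤ)).toNat = 2 * ⌊A + 1⌋₊ + 1 := by omega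
      rw [hnn] at this
      calc ((S.filter (fun n : ℤ ↦ |(n : ℝ)| ≤ A + 1)).card : ℝ) ≤ ((2 * ⌊A + 1⌋₊ + 1 : ℕ) : ℝ) := by
            exact_mod_cast this
        _ ≤ 2 * A + 5 := by push_cast; linarith
    nlinarith
  have h2 : ∑ n ∈ S.filter (fun n : ℤ ↦ ¬ |(n : ℝ)| ≤ A + 1),
      (if |(n : ℝ)| ≤ A + 1 then (4 : ℝ) else 9 / 2 * M₂ * A ^ 2 / ((|(n : ℝ)| - 1) ^ 2)) ≤
      9 / 2 * M₂ * A ^ 2 * (4 / A) := by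
    rw [Finset.sum_congr rfl fun n hn ↦ by rw [if_neg (Finset.mem_filter.1 hn).2]]
    have hS : S.filter (fun n : ℤ ↦ ¬ |(n : ℝ)| ≤ A + 1) = S.filter (fun n : ℤ ↦ A + 1 < |(n : ℝ)|) := by
      ext n; simp only [Finset.mem_filter, not_le]
    rw [hS]
    have h := sum_inv_sq_window_le S (by linarith : (1 : ℝ) ≤ A)
    calc ∑ n ∈ S.filter (fun n : ℤ ↦ A + 1 < |(n : ℝ)|), 9 / 2 * M₂ * A ^ 2 / ((|(n : ℝ)| - 1) ^ 2)
        = 9 / 2 * M₂ * A ^ 2 * ∑ n ∈ S.filter (fun n : ℤ ↦ A + 1 < |(n : ℝ)|), 1 / ((|(n : ℝ)| - 1) ^ 2) := by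
          rw [Finset.mul_sum]; exact Finset.sum_congr rfl fun n _ ↦ by ring
      _ ≤ 9 / 2 * M₂ * A ^ 2 * (4 / A) := mul_le_mul_of_nonneg_left h (by positivity)
  have hA0 : 0 < A := by linarith
  have e : 9 / 2 * M₂ * A ^ 2 * (4 / A) = 18 * M₂ * A := by field_simp; ring
  rw [e] at h2
  nlinarith

/-- The far-tail profile `(j+2)^{3/4} / (j−1)²` (set to `0` for `j ≤ 1`) is summable over `ℕ`
(comparison with `j^{−5/4}`). [folklore] -/
theorem summable_far_profile :
    Summable fun j : ℕ ↦ if j ≤ 1 then (0 : ℝ) else ((j : ℝ) + 2) ^ (3 / 4 : ℝ) / ((j : ℝ) - 1) ^ 2 := by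
  have hp : Summable fun j : ℕ ↦ ((j : ℝ) ^ (5 / 4 : ℝ))⁻¹ := Real.summable_nat_rpow_inv.2 (by norm_num)
  refine Summable.of_nonneg_of_le (fun j ↦ ?_) (fun j ↦ ?_) (hp.mul_left (2 ^ (3 / 4 : ℝ) * 4))
  · split_ifs
    · exact le_rfl
    · positivity
  · split_ifs with h
    · positivity
    · rw [not_le] at h
      have hj : (2 : ℝ) ≤ j := by exact_mod_cast h
      have hj0 : (0 : ℝ) < j := by linarith
      -- `(j+2)^{3/4} ≤ (2j)^{3/4} = 2^{3/4} j^{3/4}` and `(j-1)² ≥ j²/4`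
      have h1 : ((j : ℝ) + 2) ^ (3 / 4 : ℝ) ≤ (2 : ℝ) ^ (3 / 4 : ℝ) * (j : ℝ) ^ (3 / 4 : ℝ) := by
        rw [← Real.mul_rpow (by norm_num) hj0.le]
        exact Real.rpow_le_rpow (by linarith) (by linarith) (by norm_num)
      have h2 : (j : ℝ) ^ 2 / 4 ≤ ((j : ℝ) - 1) ^ 2 := by nlinarith
      have h3 : (j : ℝ) ^ (3 / 4 : ℝ) / ((j : ℝ) ^ 2 / 4) = 4 * ((j : ℝ) ^ (5 / 4 : ℝ))⁻¹ := by
        have : (j : ℝ) ^ 2 = (j : ℝ) ^ (3 / 4 : ℝ) * (j : ℝ) ^ (5 / 4 : ℝ) := by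
          rw [← Real.rpow_add hj0]; norm_num
        rw [this]
        field_simp
      calc ((j : ℝ) + 2) ^ (3 / 4 : ℝ) / ((j : ℝ) - 1) ^ 2
          ≤ ((2 : ℝ) ^ (3 / 4 : ℝ) * (j : ℝ) ^ (3 / 4 : ℝ)) / ((j : ℝ) ^ 2 / 4) :=
            div_le_div₀ (by positivity) h1 (by positivity) h2
        _ = (2 : ℝ) ^ (3 / 4 : ℝ) * 4 * ((j : ℝ) ^ (5 / 4 : ℝ))⁻¹ := by
            rw [mul_div_assoc, h3]; ring

end Summit.RiemannHypothesis.RiemannHypothesis.Theorems.DensityLadderSeparatedTowerWindowSums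

end
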